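import Mathlib.Analysis.Distribution.SchwartzSpace.Deriv
import Mathlib.Analysis.Calculus.LineDeriv.IntegrationByParts
import Mathlib.Analysis.InnerProductSpace.PiL2
import Mathlib.MeasureTheory.Measure.Haar.InnerProductSpace
import HarnessLib

/-!
# Moving one directional derivative across a Schwartz convolution on `ℝ³`

Stub `stub_convolutionTransfer` of the birth skeleton of the crux `TautLoopKelvin.CirculationFloor`
(item `stmt-NavierStokesRegularity-1538`): the elementary transfer rule
`(∂ₘF) ⋆ g = F ⋆ (∂ₘg)` evaluated at a point `x`, for a real Schwartz function `F` on `ℝ³` and a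
`C¹` vector field `g : ℝ³ → ℝ³` with `g` and `Dg` bounded:
`∫ ∂ₘF(t) • g(x − t) dt = ∫ F(t) • (Dg)(x − t) m dt`.

Proof. Whole-space integration by parts in the variable `t` (Mathlib's
`integral_smul_fderiv_eq_neg_fderiv_smul_of_integrable`, the scalar-times-vector instance of
`integral_bilinear_hasLineDerivAt_right_eq_neg_left_of_integrable`) applied to `F` and
`G t := g (x − t)`, whose derivative is `fderiv ℝ G t m = −(Dg)(x − t) m` (chain rule with the
affine map `t ↦ x − t`). The three integrability inputs are "integrable × bounded continuous":
`F` and `∂ₘF = LineDeriv.lineDerivOp m F` are Schwartz hence integrable (`SchwartzMap.integrable`),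
while `G`, `∂ₘG` are continuous (`g ∈ C¹`) and bounded by `M₀`, `M₁ ‖m‖`
(`MeasureTheory.Integrable.smul_bdd`). The two minus signs cancel.

Mathlib only. [folklore]
-/

noncomputable section

open MeasureTheory

namespace Summit.NavierStokesRegularity.NavierStokesRegularity.Theorems.CirculationFloor.Birth

-- the problem directory repeats the summit name; core's `dupNamespace` linter fires on every decl
set_option linter.dupNamespace false

/-- Chain rule for the reflected translate: `t ↦ g (x - t)` has derivative `-(Dg)(x - t)` at `t`
whenever `g` is differentiable. -/
theorem transfer_hasFDerivAt_comp_const_sub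
    {g : EuclideanSpace ℝ (Fin 3) → EuclideanSpace ℝ (Fin 3)} (hg : Differentiable ℝ g)
    (x t : EuclideanSpace ℝ (Fin 3)) :
    HasFDerivAt (fun s => g (x - s)) (-(fderiv ℝ g (x - t))) t := by
  have h1 : HasFDerivAt (fun s : EuclideanSpace ℝ (Fin 3) => x - s)
      (-(ContinuousLinearMap.id ℝ (EuclideanSpace ℝ (Fin 3)))) t :=
    (hasFDerivAt_id t).const_sub x
  have h2 : HasFDerivAt (fun s => g (x - s))
      ((fderiv ℝ g (x - t)).comp (-(ContinuousLinearMap.id ℝ (EuclideanSpace ℝ (Fin 3))))) t :=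
    (hg (x - t)).hasFDerivAt.comp t h1
  have h3 : (fderiv ℝ g (x - t)).comp (-(ContinuousLinearMap.id ℝ (EuclideanSpace ℝ (Fin 3)))) =
      -(fderiv ℝ g (x - t)) := by
    rw [ContinuousLinearMap.comp_neg, ContinuousLinearMap.comp_id]
  rw [← h3]
  exact h2

/-- The derivative of the reflected translate in the direction `m`:
`fderiv ℝ (fun s => g (x - s)) t m = -(fderiv ℝ g (x - t) m)`. -/
theorem transfer_fderiv_comp_const_sub_apply
    {g : EuclideanSpace ℝ (Fin 3) → EuclideanSpace ℝ (Fin 3)} (hg : Differentiable ℝ g)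
    (x t m : EuclideanSpace ℝ (Fin 3)) :
    fderiv ℝ (fun s => g (x - s)) t m = -(fderiv ℝ g (x - t) m) := by
  rw [(transfer_hasFDerivAt_comp_const_sub hg x t).fderiv]
  simp

/-- "Integrable scalar × bounded continuous vector" is integrable (Bochner, any measure on `ℝ³`
for which continuity gives a.e.-strong measurability). -/
theorem transfer_integrable_smul_of_bdd
    {φ : EuclideanSpace ℝ (Fin 3) → ℝ} {f : EuclideanSpace ℝ (Fin 3) → EuclideanSpace ℝ (Fin 3)}
    (hφ : Integrable φ) (hf : Continuous f) (C : ℝ) (hC : ∀ t, ‖f t‖ ≤ C) :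
    Integrable (fun t => φ t • f t) := by
  have h := hφ.smul_bdd C hf.aestronglyMeasurable (Filter.Eventually.of_forall hC)
  simpa [Pi.smul_def'] using h

/-- **Stub T — `stub_convolutionTransfer` (whole-space integration by parts).** For a real
Schwartz function `F` on `ℝ³`, a `C¹` field `g` with `g` and `Dg` bounded, and a direction `m`:
`∫ ∂ₘF(t) • g(x − t) dt = ∫ F(t) • (Dg)(x − t) m dt` — the derivative moves across the
convolution. -/
theorem stub_convolutionTransfer :
    ∀ (F : SchwartzMap (EuclideanSpace ℝ (Fin 3)) ℝ)
      (g : EuclideanSpace ℝ (Fin 3) → EuclideanSpace ℝ (Fin 3)) (m : EuclideanSpace ℝ (Fin 3)) (M₀ M₁ : ℝ),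
      ContDiff ℝ 1 g → (∀ x, ‖g x‖ ≤ M₀) → (∀ x, ‖fderiv ℝ g x‖ ≤ M₁) →
      ∀ x : EuclideanSpace ℝ (Fin 3),
        ∫ t, (fderiv ℝ (fun z => F z) t m) • g (x - t) = ∫ t, F t • fderiv ℝ g (x - t) m := by
  intro F g m M₀ M₁ hg hg0 hg1 x
  have hgd : Differentiable ℝ g := hg.differentiable one_ne_zero
  have hgc : Continuous g := hg.continuous
  have hgfc : Continuous (fderiv ℝ g) := hg.continuous_fderiv one_ne_zero
  -- the reflected translate and its derivative
  set G : EuclideanSpace ℝ (Fin 3) → EuclideanSpace ℝ (Fin 3) := fun s => g (x - s)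
  have hGd : ∀ t, HasFDerivAt G (-(fderiv ℝ g (x - t))) t :=
    fun t => transfer_hasFDerivAt_comp_const_sub hgd x t
  have hGm : ∀ t, fderiv ℝ G t m = -(fderiv ℝ g (x - t) m) :=
    fun t => transfer_fderiv_comp_const_sub_apply hgd x t m
  have hGc : Continuous G := hgc.comp (continuous_const.sub continuous_id)
  have hG'c : Continuous fun t => fderiv ℝ G t m := by
    have : Continuous fun t => -(fderiv ℝ g (x - t) m) :=
      ((hgfc.comp (continuous_const.sub continuous_id)).clm_apply continuous_const).neg
    exact this.congr fun t => (hGm t).symm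
  have hG0 : ∀ t, ‖G t‖ ≤ M₀ := fun t => hg0 (x - t)
  have hG1 : ∀ t, ‖fderiv ℝ G t m‖ ≤ M₁ * ‖m‖ := by
    intro t
    rw [hGm t, norm_neg]
    exact (fderiv ℝ g (x - t)).le_of_opNorm_le (hg1 (x - t)) m
  -- integrability inputs
  have hFi : Integrable (⇑F) := F.integrable
  have hF'i : Integrable (fun t => fderiv ℝ (⇑F) t m) := by
    have h := (LineDeriv.lineDerivOp m F : SchwartzMap (EuclideanSpace ℝ (Fin 3)) ℝ).integrable
      (μ := (volume : Measure (EuclideanSpace ℝ (Fin 3))))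
    refine h.congr (Filter.Eventually.of_forall fun t => ?_)
    exact SchwartzMap.lineDerivOp_apply_eq_fderiv m F t
  have h1 : Integrable (fun t => fderiv ℝ (⇑F) t m • G t) :=
    transfer_integrable_smul_of_bdd hF'i hGc M₀ hG0
  have h2 : Integrable (fun t => F t • fderiv ℝ G t m) :=
    transfer_integrable_smul_of_bdd hFi hG'c (M₁ * ‖m‖) hG1
  have h3 : Integrable (fun t => F t • G t) :=
    transfer_integrable_smul_of_bdd hFi hGc M₀ hG0
  -- integration by parts
  have key := integral_smul_fderiv_eq_neg_fderiv_smul_of_integrable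
    (μ := (volume : Measure (EuclideanSpace ℝ (Fin 3)))) (f := ⇑F) (g := G) (v := m) h1 h2 h3
    (fun t _ => F.differentiableAt) (fun t _ => (hGd t).differentiableAt)
  -- `key : ∫ t, F t • fderiv ℝ G t m = -∫ t, fderiv ℝ F t m • G t`
  have key' : ∫ t, fderiv ℝ (⇑F) t m • G t = -∫ t, F t • fderiv ℝ G t m := by
    rw [key, neg_neg]
  calc ∫ t, (fderiv ℝ (fun z => F z) t m) • g (x - t)
      = ∫ t, fderiv ℝ (⇑F) t m • G t := rfl
    _ = -∫ t, F t • fderiv ℝ G t m := key'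
    _ = -∫ t, F t • -(fderiv ℝ g (x - t) m) := by simp_rw [hGm]
    _ = ∫ t, F t • fderiv ℝ g (x - t) m := by
      simp_rw [smul_neg, integral_neg, neg_neg]

end Summit.NavierStokesRegularity.NavierStokesRegularity.Theorems.CirculationFloor.Birth

end
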